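import Summits.QuantumFields.BalabanUV.Beta.FP.KKTSecondVariation
import Summits.QuantumFields.BalabanUV.Beta.FP.GhostGramSplit

/-!
# `BalabanUV.Beta.FP.GhostGramJets` — road «FP» (binder row D1), organisation γ, row GAMMA-9 (a) MODEL, FILE 2:
# **JETS OF THE THREE BLOCKS AND OF THE INTERPOLATION GRAM; THE POLARIZATION OF THE K_n-GHOST = SIX KKT LOOPS AT THE SCALAR DATA + GRAM LOOPS**

HONEST DEPENDENCY (page 1, mandatory): continuum YM on T⁴ ⇐ BetaPertH ∧ nine spine estimates (0/9 proved); BetaPertH ⇐ (D1) ∧ (D4) ∧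
CAP+tail; G-an2-4 gates asym, D1 and NE2/3/4.  HONEST FRAMING (cell contract, verbatim): «discharging `BetaPertH` makes Bałaban's UV
stability UNCONDITIONAL — a real constructive-QFT result; it is NOT the continuum limit and NOT the Clay problem.»  THIS MODULE DISCHARGES
NOTHING of the wall: [folklore] block algebra + one-variable calculus over the tree's `Beta.CompositionSingular` (`flucCov`, `minOp`, `minOpL`,
`effForm`, `kktInv_eq_fromBlocks`, `minOpL_eq_transpose`), `D1BFx.LogDetSecondVariation` (`secondVar`, `hasDerivAt_inv_entry`,
`hasDerivAt_logAbsDet`, `hasDerivAt_trace_inv_mul`), `D1BFx.SliceTransferModel` (`hasDerivAt_kkt`, `hasDerivAt_matMul`, `hasDerivAt_transpose_mul`),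
`FP.KKTSecondVariation` (`hasDerivAt_logAbsDet_kkt`, `hasDerivAt_firstVar_kkt`, `sixLoops_kkt`) and FILE 1 `FP.GhostGramSplit`
(`ghostLogDet_eq_kkt_add_gram_of_reg`, `posDef_gram`), all BY NAME.  No `def`, no `def … : Prop`, nothing cited, 0 sorry; 0∕4 binders of row D1;
NOT hbook, NOT D1, NOT BetaPertH, NOT continuum, NOT Clay.

ABSOLUTE RULE (cell charter, verbatim): «No internally-minted statement may enter as a cited fact. Every hypothesis is either kernel-proved
in this package or a verbatim quotation of a PUBLISHED theorem with page reference. The manuscript(s) under audit are NOT citable for their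
own disputed steps — they are the thing under adjudication; programme-internal (2001/route/tribunal) claims are never citable.»

CONTENT (curves `ℝ → ι → κ → ℝ` read through `Matrix.of`, the binder style of `KKTSecondVariation` §2).
* §1 ALGEBRA: `kktInv_mul_kkt_mul_kktInv` — the four blocks of `𝕂⁻¹·kkt H₁ Q₁·𝕂⁻¹` for symmetric `H` (`𝕂 = kkt H Q`, `𝕂⁻¹ = [[Γ, 𝓘],[𝓘ᵀ, −𝔊]]`):
  `₁₁ = ΓH₁Γ + 𝓘Q₁Γ + ΓQ₁ᵀ𝓘ᵀ`, `₁₂ = ΓH₁𝓘 + 𝓘Q₁𝓘 − ΓQ₁ᵀ𝔊`, `₂₁ = 𝓘ᵀH₁Γ − 𝔊Q₁Γ + 𝓘ᵀQ₁ᵀ𝓘ᵀ`, `₂₂ = 𝓘ᵀH₁𝓘 − 𝔊Q₁𝓘 − 𝓘ᵀQ₁ᵀ𝔊`.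
* §2 CALCULUS OF THE BLOCKS: `hasDerivAt_kktInv` (`(𝕂⁻¹)˙ = −𝕂⁻¹𝕂̇𝕂⁻¹`), and the three named jets **`hasDerivAt_flucCov`** (`Γ̇ = −(ΓḢΓ + 𝓘Q̇Γ + ΓQ̇ᵀ𝓘ᵀ)`),
  **`hasDerivAt_minOp`** (`𝓘̇ = −ΓḢ𝓘 − 𝓘Q̇𝓘 + ΓQ̇ᵀ𝔊`), **`hasDerivAt_effForm`** (`𝔊̇ = 𝓘ᵀḢ𝓘 − 𝔊Q̇𝓘 − 𝓘ᵀQ̇ᵀ𝔊`).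
  `hasDerivAt_minOp_eventually` (the jet near a non-degenerate point — the `hI` input of §5).
* §3 THE GRAM: `hasDerivAt_gram` (`(𝓘ᵀ𝓘)˙ = 𝓘̇ᵀ𝓘 + 𝓘ᵀ𝓘̇`), `hasDerivAt_log_det_gram` (`(log det 𝓘ᵀ𝓘)˙ = tr((𝓘ᵀ𝓘)⁻¹(𝓘ᵀ𝓘)˙)`).
* §4 **THE FIRST VARIATION OF THE K_n-GHOST** `hasDerivAt_ghostLogDet`: under Bałaban-type regularity near `t` (symmetric `L u`, one fixed symmetric `A`
  with `L u + (Q u)ᵀA(Q u)` and its block propagator invertible near `t`) and `QQᵀ` invertible at `t`,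
  `(ghostLogDet (L u) (Q u))′(t) = [tr(Γ L̇) + 2tr(𝓘 Q̇)] + ½·tr((𝓘ᵀ𝓘)⁻¹(𝓘̇ᵀ𝓘 + 𝓘ᵀ𝓘̇)) − ½·tr((QQᵀ)⁻¹(Q̇Qᵀ + QQ̇ᵀ))` —
  (−2)× the first variation of pv25's `logZ` at the scalar data (`hasDerivAt_logAbsDet_kkt` BY NAME) + the Gram's + the constraint constant's
  (FILE 1's singular-safe split `ghostLogDet_eq_kkt_add_gram_of_reg` holds on a neighbourhood of `t`).
* §5 **THE POLARIZATION** `hasDerivAt_ghostFirstVar`: the derivative at `t` of the first-variation density is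
  `secondVar 𝕂 𝕂̇ 𝕂̈ + ½·secondVar (𝓘ᵀ𝓘) Ṁ M̈ − ½·secondVar (QQᵀ) Ċ C̈`, `Ṁ = I₁ᵀ𝓘 + 𝓘ᵀI₁`, `M̈ = I₂ᵀ𝓘 + 2I₁ᵀI₁ + 𝓘ᵀI₂` (`I₁, I₂` the jets of `𝓘`;
  `hasDerivAt_gramFirstVar`), and `secondVar 𝕂 𝕂̇ 𝕂̈ = −2·(SIX LOOPS)` (`secondVar_kkt_eq_neg_two_mul_sixLoops` = `KKTSecondVariation.sixLoops_kkt` at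
  the scalar data `(H, Q) := (L, Q)` BY NAME) — the GRAM LOOP CATALOGUE has legs in {`Γ, 𝓘, 𝔊, (𝓘ᵀ𝓘)⁻¹`} and vertices in {`L̇, L̈, Q̇, Q̈`} only.
READING (orientation only): on the road `(L, Q) = (Δ_B, Q′_B)`, `B = U_n(tv)`, and §5 is the coarse V-Hessian `T^{gh}_n` of the owner's GAMMA-9 re-cut
(GAMMA-DESIGN v1.3 §11 (GH-a)); `QQᵀ` is static for unitary transports (the `C`-terms vanish).  NOT HERE: letters, power counting, `U_n`, the near
bound `B_gh` itself.
Unit `b2b-balaban-beta-d1-formalise-leaf-05` (gen 12), 2026-08-21; `LEAVES-FP.md` row GAMMA-9 (a); journal INTENT 01:52:34Z.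
-/

noncomputable section

namespace Summit.QuantumFields.BalabanUV.Beta.FP.GhostGramJets

open Matrix Filter
open scoped Matrix BigOperators Topology
open Literature.MathematicalPhysics.QuantumFieldTheory.Balaban1983to89.Beta
open Literature.MathematicalPhysics.QuantumFieldTheory.Balaban1983to89.Beta.Composition (kkt blockProp logZ)
open Literature.MathematicalPhysics.QuantumFieldTheory.Balaban1983to89.Beta.CompositionSingular (flucCov minOp minOpL effForm
  kktInv_eq_fromBlocks kkt_eq_fromBlocks minOpL_eq_transpose isUnit_kkt_det_of_reg)
open Summit.QuantumFields.BalabanUV.Beta.D1BFx.LogDetSecondVariation (secondVar hasDerivAt_inv_entry hasDerivAt_logAbsDet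
  hasDerivAt_trace_inv_mul)
open Summit.QuantumFields.BalabanUV.Beta.D1BFx.SliceTransferModel (hasDerivAt_kkt hasDerivAt_matMul hasDerivAt_transpose_mul
  hasDerivAt_transpose hasDerivAt_entry)
open Summit.QuantumFields.BalabanUV.Beta.FP.KKTSecondVariation (hasDerivAt_logAbsDet_kkt hasDerivAt_firstVar_kkt sixLoops_kkt
  trace_kktInv_mul_kkt_symm)
open Literature.Analysis.Calculus (eventually_det_ne_zero)
open Summit.QuantumFields.BalabanUV.Beta.FP.GhostDeterminantModel (ghostLogDet)
open Summit.QuantumFields.BalabanUV.Beta.FP.GhostGramSplit (ghostLogDet_eq_kkt_add_gram_of_reg posDef_gram det_gram_pos)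

/-! ## §1 Algebra: the sandwich `𝕂⁻¹·𝕂̇·𝕂⁻¹` in the three blocks -/

section Algebra

variable {𝕜 : Type*} [Field 𝕜]
variable {ν μ : Type*} [Fintype ν] [Fintype μ] [DecidableEq ν] [DecidableEq μ]

/-- [folklore] **THE SANDWICH IN BLOCKS** (symmetric `H`, so `minOpL = 𝓘ᵀ`; no invertibility — the blocks ARE those of `(kkt H Q)⁻¹`):
`(kkt H Q)⁻¹ · kkt H₁ Q₁ · (kkt H Q)⁻¹ = [[ΓH₁Γ + 𝓘Q₁Γ + ΓQ₁ᵀ𝓘ᵀ, ΓH₁𝓘 + 𝓘Q₁𝓘 − ΓQ₁ᵀ𝔊],[𝓘ᵀH₁Γ − 𝔊Q₁Γ + 𝓘ᵀQ₁ᵀ𝓘ᵀ, 𝓘ᵀH₁𝓘 − 𝔊Q₁𝓘 − 𝓘ᵀQ₁ᵀ𝔊]]`. -/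
theorem kktInv_mul_kkt_mul_kktInv (H H₁ : Matrix ν ν 𝕜) (Q Q₁ : Matrix μ ν 𝕜) (hH : Hᵀ = H) :
    (kkt H Q)⁻¹ * kkt H₁ Q₁ * (kkt H Q)⁻¹ =
      fromBlocks
        (flucCov H Q * H₁ * flucCov H Q + minOp H Q * Q₁ * flucCov H Q + flucCov H Q * Q₁ᵀ * (minOp H Q)ᵀ)
        (flucCov H Q * H₁ * minOp H Q + minOp H Q * Q₁ * minOp H Q - flucCov H Q * Q₁ᵀ * effForm H Q)
        ((minOp H Q)ᵀ * H₁ * flucCov H Q - effForm H Q * Q₁ * flucCov H Q + (minOp H Q)ᵀ * Q₁ᵀ * (minOp H Q)ᵀ)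
        ((minOp H Q)ᵀ * H₁ * minOp H Q - effForm H Q * Q₁ * minOp H Q - (minOp H Q)ᵀ * Q₁ᵀ * effForm H Q) := by
  rw [kktInv_eq_fromBlocks, (minOpL_eq_transpose H Q hH).1, kkt_eq_fromBlocks H₁ Q₁, fromBlocks_multiply, fromBlocks_multiply]
  simp only [Matrix.mul_zero, add_zero, Matrix.add_mul, Matrix.neg_mul, Matrix.mul_neg, Matrix.mul_assoc]
  congr 1 <;> abel

end Algebra

/-! ## §2 Calculus of the three blocks along a curve -/

section Calculus

variable {ν μ : Type*} [Fintype ν] [Fintype μ] [DecidableEq ν] [DecidableEq μ]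

/-- [folklore] **JET OF THE BORDERED INVERSE**: if `H`, `Q` have derivatives `H₁`, `Q₁` at `t` and `det kkt(H t)(Q t) ≠ 0`, the curve
`u ↦ (kkt (H u) (Q u))⁻¹` has derivative `−𝕂⁻¹·kkt H₁ Q₁·𝕂⁻¹` at `t` (`𝕂 = kkt (H t) (Q t)`). -/
theorem hasDerivAt_kktInv {H : ℝ → ν → ν → ℝ} {Q : ℝ → μ → ν → ℝ} {H₁ : Matrix ν ν ℝ} {Q₁ : Matrix μ ν ℝ} {t : ℝ}
    (hH : HasDerivAt H (Matrix.of.symm H₁) t) (hQ : HasDerivAt Q (Matrix.of.symm Q₁) t)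
    (hdet : (kkt (Matrix.of (H t)) (Matrix.of (Q t))).det ≠ 0) :
    HasDerivAt (fun u => Matrix.of.symm (kkt (Matrix.of (H u)) (Matrix.of (Q u)))⁻¹)
      (Matrix.of.symm (-((kkt (Matrix.of (H t)) (Matrix.of (Q t)))⁻¹ * kkt H₁ Q₁ * (kkt (Matrix.of (H t)) (Matrix.of (Q t)))⁻¹))) t := by
  have hK := hasDerivAt_kkt hH hQ
  refine hasDerivAt_pi.2 fun a => hasDerivAt_pi.2 fun b => ?_
  exact hasDerivAt_inv_entry (A := fun u => Matrix.of.symm (kkt (Matrix.of (H u)) (Matrix.of (Q u)))) (A₁ := kkt H₁ Q₁) hK hdet a b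

/-- [folklore] **JET OF THE MINIMISER**: `𝓘̇ = −(ΓḢ𝓘 + 𝓘Q̇𝓘 − ΓQ̇ᵀ𝔊)` — for `H t` symmetric and `det kkt(H t)(Q t) ≠ 0`, the curve
`u ↦ minOp (H u) (Q u)` has that derivative at `t` (`Γ, 𝓘, 𝔊` at `t`; `Ḣ = H₁`, `Q̇ = Q₁`). -/
theorem hasDerivAt_minOp {H : ℝ → ν → ν → ℝ} {Q : ℝ → μ → ν → ℝ} {H₁ : Matrix ν ν ℝ} {Q₁ : Matrix μ ν ℝ} {t : ℝ}
    (hH : HasDerivAt H (Matrix.of.symm H₁) t) (hQ : HasDerivAt Q (Matrix.of.symm Q₁) t)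
    (hsym : (Matrix.of (H t))ᵀ = Matrix.of (H t)) (hdet : (kkt (Matrix.of (H t)) (Matrix.of (Q t))).det ≠ 0) :
    HasDerivAt (fun u => Matrix.of.symm (minOp (Matrix.of (H u)) (Matrix.of (Q u))))
      (Matrix.of.symm (-(flucCov (Matrix.of (H t)) (Matrix.of (Q t)) * H₁ * minOp (Matrix.of (H t)) (Matrix.of (Q t))
          + minOp (Matrix.of (H t)) (Matrix.of (Q t)) * Q₁ * minOp (Matrix.of (H t)) (Matrix.of (Q t))
          - flucCov (Matrix.of (H t)) (Matrix.of (Q t)) * Q₁ᵀ * effForm (Matrix.of (H t)) (Matrix.of (Q t))))) t := by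
  have hK := hasDerivAt_kktInv hH hQ hdet
  rw [kktInv_mul_kkt_mul_kktInv _ H₁ _ Q₁ hsym, fromBlocks_neg] at hK
  refine hasDerivAt_pi.2 fun i => hasDerivAt_pi.2 fun m => ?_
  have h := (hasDerivAt_pi.1 ((hasDerivAt_pi.1 hK) (Sum.inl i))) (Sum.inr m)
  simp only [Matrix.of_symm_apply, fromBlocks_apply₁₂] at h
  simp only [Matrix.of_symm_apply]
  refine h.congr_of_eventuallyEq (Eventually.of_forall fun u => ?_)
  simp only [minOp, Matrix.toBlocks₁₂, Matrix.of_apply]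

/-- [folklore] **JET OF THE FLUCTUATION COVARIANCE**: `Γ̇ = −(ΓḢΓ + 𝓘Q̇Γ + ΓQ̇ᵀ𝓘ᵀ)`. -/
theorem hasDerivAt_flucCov {H : ℝ → ν → ν → ℝ} {Q : ℝ → μ → ν → ℝ} {H₁ : Matrix ν ν ℝ} {Q₁ : Matrix μ ν ℝ} {t : ℝ}
    (hH : HasDerivAt H (Matrix.of.symm H₁) t) (hQ : HasDerivAt Q (Matrix.of.symm Q₁) t)
    (hsym : (Matrix.of (H t))ᵀ = Matrix.of (H t)) (hdet : (kkt (Matrix.of (H t)) (Matrix.of (Q t))).det ≠ 0) :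
    HasDerivAt (fun u => Matrix.of.symm (flucCov (Matrix.of (H u)) (Matrix.of (Q u))))
      (Matrix.of.symm (-(flucCov (Matrix.of (H t)) (Matrix.of (Q t)) * H₁ * flucCov (Matrix.of (H t)) (Matrix.of (Q t))
          + minOp (Matrix.of (H t)) (Matrix.of (Q t)) * Q₁ * flucCov (Matrix.of (H t)) (Matrix.of (Q t))
          + flucCov (Matrix.of (H t)) (Matrix.of (Q t)) * Q₁ᵀ * (minOp (Matrix.of (H t)) (Matrix.of (Q t)))ᵀ))) t := by
  have hK := hasDerivAt_kktInv hH hQ hdet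
  rw [kktInv_mul_kkt_mul_kktInv _ H₁ _ Q₁ hsym, fromBlocks_neg] at hK
  refine hasDerivAt_pi.2 fun i => hasDerivAt_pi.2 fun j => ?_
  have h := (hasDerivAt_pi.1 ((hasDerivAt_pi.1 hK) (Sum.inl i))) (Sum.inl j)
  simp only [Matrix.of_symm_apply, fromBlocks_apply₁₁] at h
  simp only [Matrix.of_symm_apply]
  refine h.congr_of_eventuallyEq (Eventually.of_forall fun u => ?_)
  simp only [flucCov, Matrix.toBlocks₁₁, Matrix.of_apply]

/-- [folklore] **JET OF THE EFFECTIVE FORM**: `𝔊̇ = 𝓘ᵀḢ𝓘 − 𝔊Q̇𝓘 − 𝓘ᵀQ̇ᵀ𝔊`. -/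
theorem hasDerivAt_effForm {H : ℝ → ν → ν → ℝ} {Q : ℝ → μ → ν → ℝ} {H₁ : Matrix ν ν ℝ} {Q₁ : Matrix μ ν ℝ} {t : ℝ}
    (hH : HasDerivAt H (Matrix.of.symm H₁) t) (hQ : HasDerivAt Q (Matrix.of.symm Q₁) t)
    (hsym : (Matrix.of (H t))ᵀ = Matrix.of (H t)) (hdet : (kkt (Matrix.of (H t)) (Matrix.of (Q t))).det ≠ 0) :
    HasDerivAt (fun u => Matrix.of.symm (effForm (Matrix.of (H u)) (Matrix.of (Q u))))
      (Matrix.of.symm ((minOp (Matrix.of (H t)) (Matrix.of (Q t)))ᵀ * H₁ * minOp (Matrix.of (H t)) (Matrix.of (Q t))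
          - effForm (Matrix.of (H t)) (Matrix.of (Q t)) * Q₁ * minOp (Matrix.of (H t)) (Matrix.of (Q t))
          - (minOp (Matrix.of (H t)) (Matrix.of (Q t)))ᵀ * Q₁ᵀ * effForm (Matrix.of (H t)) (Matrix.of (Q t)))) t := by
  have hK := hasDerivAt_kktInv hH hQ hdet
  rw [kktInv_mul_kkt_mul_kktInv _ H₁ _ Q₁ hsym, fromBlocks_neg] at hK
  refine hasDerivAt_pi.2 fun m => hasDerivAt_pi.2 fun m' => ?_
  have h := ((hasDerivAt_pi.1 ((hasDerivAt_pi.1 hK) (Sum.inr m))) (Sum.inr m')).neg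
  simp only [Matrix.of_symm_apply, fromBlocks_apply₂₂, Matrix.neg_apply, neg_neg] at h
  simp only [Matrix.of_symm_apply]
  refine h.congr_of_eventuallyEq (Eventually.of_forall fun u => ?_)
  simp only [effForm, Matrix.toBlocks₂₂, Matrix.of_apply, Matrix.neg_apply, Pi.neg_apply]

/-- [folklore] The minimiser's jet NEAR a non-degenerate point: if `H`, `Q` have derivatives `H₁ u`, `Q₁ u` at every `u` near `t`, `H u` is symmetric
near `t` and `det kkt(H t)(Q t) ≠ 0`, then near `t` the curve `u ↦ minOp (H u) (Q u)` has derivative `−(Γ_uḢ_u𝓘_u + 𝓘_uQ̇_u𝓘_u − Γ_uQ̇_uᵀ𝔊_u)`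
(non-degeneracy propagates, `eventually_det_ne_zero`) — the `hI` input of §5. -/
theorem hasDerivAt_minOp_eventually {H H₁ : ℝ → ν → ν → ℝ} {Q Q₁ : ℝ → μ → ν → ℝ} {t : ℝ}
    (hH : ∀ᶠ u in 𝓝 t, HasDerivAt H (H₁ u) u) (hQ : ∀ᶠ u in 𝓝 t, HasDerivAt Q (Q₁ u) u)
    (hsym : ∀ᶠ u in 𝓝 t, (Matrix.of (H u))ᵀ = Matrix.of (H u)) (hdet : (kkt (Matrix.of (H t)) (Matrix.of (Q t))).det ≠ 0) :
    ∀ᶠ u in 𝓝 t, HasDerivAt (fun u => Matrix.of.symm (minOp (Matrix.of (H u)) (Matrix.of (Q u))))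
      (Matrix.of.symm (-(flucCov (Matrix.of (H u)) (Matrix.of (Q u)) * Matrix.of (H₁ u) * minOp (Matrix.of (H u)) (Matrix.of (Q u))
          + minOp (Matrix.of (H u)) (Matrix.of (Q u)) * Matrix.of (Q₁ u) * minOp (Matrix.of (H u)) (Matrix.of (Q u))
          - flucCov (Matrix.of (H u)) (Matrix.of (Q u)) * (Matrix.of (Q₁ u))ᵀ * effForm (Matrix.of (H u)) (Matrix.of (Q u))))) u := by
  have hH' : ∀ᶠ u in 𝓝 t, HasDerivAt H (Matrix.of.symm (Matrix.of (H₁ u))) u := hH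
  have hQ' : ∀ᶠ u in 𝓝 t, HasDerivAt Q (Matrix.of.symm (Matrix.of (Q₁ u))) u := hQ
  have hK : HasDerivAt (fun u => Matrix.of.symm (kkt (Matrix.of (H u)) (Matrix.of (Q u))))
      (Matrix.of.symm (kkt (Matrix.of (H₁ t)) (Matrix.of (Q₁ t)))) t := hasDerivAt_kkt hH.self_of_nhds hQ.self_of_nhds
  have hdet' : ∀ᶠ u in 𝓝 t, (Matrix.of (Matrix.of.symm (kkt (Matrix.of (H u)) (Matrix.of (Q u))))).det ≠ 0 :=
    eventually_det_ne_zero hK.hasFDerivAt hdet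
  filter_upwards [hH', hQ', hsym, hdet'] with u huH huQ hus hud
  exact hasDerivAt_minOp huH huQ hus hud

/-! ## §3 The interpolation Gram along the curve -/

/-- [folklore] **JET OF THE GRAM** `(𝓘ᵀ𝓘)˙ = 𝓘̇ᵀ𝓘 + 𝓘ᵀ𝓘̇`, abstract first jet: if `u ↦ minOp (H u) (Q u)` has derivative `I₁` at `t` then
`u ↦ (minOp …)ᵀ·minOp …` has derivative `I₁ᵀ𝓘 + 𝓘ᵀI₁`. -/
theorem hasDerivAt_gram {H : ℝ → ν → ν → ℝ} {Q : ℝ → μ → ν → ℝ} {I₁ : Matrix ν μ ℝ} {t : ℝ}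
    (hI : HasDerivAt (fun u => Matrix.of.symm (minOp (Matrix.of (H u)) (Matrix.of (Q u)))) (Matrix.of.symm I₁) t) :
    HasDerivAt (fun u => Matrix.of.symm ((minOp (Matrix.of (H u)) (Matrix.of (Q u)))ᵀ * minOp (Matrix.of (H u)) (Matrix.of (Q u))))
      (Matrix.of.symm (I₁ᵀ * minOp (Matrix.of (H t)) (Matrix.of (Q t)) + (minOp (Matrix.of (H t)) (Matrix.of (Q t)))ᵀ * I₁)) t := by
  have h := hasDerivAt_transpose_mul (X := fun u => Matrix.of.symm (minOp (Matrix.of (H u)) (Matrix.of (Q u))))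
    (Y := fun u => Matrix.of.symm (minOp (Matrix.of (H u)) (Matrix.of (Q u)))) hI hI
  exact h

/-- [folklore] **JET OF THE LOG-GRAM** `(log det(𝓘ᵀ𝓘))˙ = tr((𝓘ᵀ𝓘)⁻¹·(𝓘̇ᵀ𝓘 + 𝓘ᵀ𝓘̇))` (the Gram is positive definite when the bordered
matrix is invertible, `GhostGramSplit.posDef_gram`, so `log det = log|det|`). -/
theorem hasDerivAt_log_det_gram {H : ℝ → ν → ν → ℝ} {Q : ℝ → μ → ν → ℝ} {I₁ : Matrix ν μ ℝ} {t : ℝ}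
    (hI : HasDerivAt (fun u => Matrix.of.symm (minOp (Matrix.of (H u)) (Matrix.of (Q u)))) (Matrix.of.symm I₁) t)
    (hdet : ∀ᶠ u in 𝓝 t, (kkt (Matrix.of (H u)) (Matrix.of (Q u))).det ≠ 0) :
    HasDerivAt (fun u => Real.log ((minOp (Matrix.of (H u)) (Matrix.of (Q u)))ᵀ * minOp (Matrix.of (H u)) (Matrix.of (Q u))).det)
      ((((minOp (Matrix.of (H t)) (Matrix.of (Q t)))ᵀ * minOp (Matrix.of (H t)) (Matrix.of (Q t)))⁻¹
        * (I₁ᵀ * minOp (Matrix.of (H t)) (Matrix.of (Q t)) + (minOp (Matrix.of (H t)) (Matrix.of (Q t)))ᵀ * I₁)).trace) t := by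
  have hG := hasDerivAt_gram hI
  have hpos : 0 < ((minOp (Matrix.of (H t)) (Matrix.of (Q t)))ᵀ * minOp (Matrix.of (H t)) (Matrix.of (Q t))).det :=
    det_gram_pos _ _ (isUnit_iff_ne_zero.2 hdet.self_of_nhds)
  have h := hasDerivAt_logAbsDet
    (A := fun u => Matrix.of.symm ((minOp (Matrix.of (H u)) (Matrix.of (Q u)))ᵀ * minOp (Matrix.of (H u)) (Matrix.of (Q u))))
    (A₁ := I₁ᵀ * minOp (Matrix.of (H t)) (Matrix.of (Q t)) + (minOp (Matrix.of (H t)) (Matrix.of (Q t)))ᵀ * I₁) hG hpos.ne'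
  refine h.congr_of_eventuallyEq ?_
  filter_upwards [hdet] with u hu
  exact congrArg Real.log (abs_of_pos (det_gram_pos _ _ (isUnit_iff_ne_zero.2 hu))).symm

/-! ## §4 The first variation of the K_n-ghost along a curve -/

omit [DecidableEq ν] [DecidableEq μ] in
/-- [folklore] Jet of the constraint Gram `(QQᵀ)˙ = Q̇Qᵀ + QQ̇ᵀ`. -/
theorem hasDerivAt_gramQ {Q : ℝ → μ → ν → ℝ} {Q₁ : Matrix μ ν ℝ} {t : ℝ} (hQ : HasDerivAt Q (Matrix.of.symm Q₁) t) :
    HasDerivAt (fun u => Matrix.of.symm (Matrix.of (Q u) * (Matrix.of (Q u))ᵀ))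
      (Matrix.of.symm (Q₁ * (Matrix.of (Q t))ᵀ + Matrix.of (Q t) * Q₁ᵀ)) t :=
  hasDerivAt_matMul (Y := fun u => Matrix.of.symm (Matrix.of (Q u))ᵀ) hQ (hasDerivAt_transpose hQ)

/-- [folklore] **THE FIRST VARIATION OF THE K_n-GHOST ALONG A CURVE.**  Data: curves `u ↦ L u` (symmetric near `t`), `u ↦ Q u` with
derivatives `L₁`, `Q₁` at `t`; Bałaban-type regularity NEAR `t` for one fixed symmetric `A` (`L u + (Q u)ᵀA(Q u)` and its block propagator
invertible — the `a‖Q·‖²` term); the constraint Gram `Q t (Q t)ᵀ` invertible.  Then, with `Γ, 𝓘, 𝔊` the three blocks at `t` and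
`𝓘̇ := −(ΓL₁𝓘 + 𝓘Q₁𝓘 − ΓQ₁ᵀ𝔊)`,
`(ghostLogDet (L u) (Q u))′(t) = [tr(Γ L₁) + 2·tr(𝓘 Q₁)] + ½·tr((𝓘ᵀ𝓘)⁻¹(𝓘̇ᵀ𝓘 + 𝓘ᵀ𝓘̇)) − ½·tr((QQᵀ)⁻¹(Q₁Qᵀ + QQ₁ᵀ))`
— (−2)× the first variation of pv25's `logZ` at the scalar data (`KKTSecondVariation.hasDerivAt_logAbsDet_kkt` BY NAME) + the Gram's + the
constraint constant's (zero on the road for unitary transports). -/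
theorem hasDerivAt_ghostLogDet {L : ℝ → ν → ν → ℝ} {Q : ℝ → μ → ν → ℝ} {L₁ : Matrix ν ν ℝ} {Q₁ : Matrix μ ν ℝ} {t : ℝ}
    (A : Matrix μ μ ℝ) (hA : Aᵀ = A)
    (hL : HasDerivAt L (Matrix.of.symm L₁) t) (hQ : HasDerivAt Q (Matrix.of.symm Q₁) t)
    (hsym : ∀ᶠ u in 𝓝 t, (Matrix.of (L u))ᵀ = Matrix.of (L u))
    (hK : ∀ᶠ u in 𝓝 t, IsUnit (Matrix.of (L u) + (Matrix.of (Q u))ᵀ * A * Matrix.of (Q u)).det)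
    (hPK : ∀ᶠ u in 𝓝 t, IsUnit (blockProp (Matrix.of (L u) + (Matrix.of (Q u))ᵀ * A * Matrix.of (Q u)) (Matrix.of (Q u))).det)
    (hG : (Matrix.of (Q t) * (Matrix.of (Q t))ᵀ).det ≠ 0) :
    HasDerivAt (fun u => ghostLogDet (Matrix.of (L u)) (Matrix.of (Q u)))
      ((flucCov (Matrix.of (L t)) (Matrix.of (Q t)) * L₁).trace + 2 * (minOp (Matrix.of (L t)) (Matrix.of (Q t)) * Q₁).trace
        + (1 / 2 : ℝ) * ((((minOp (Matrix.of (L t)) (Matrix.of (Q t)))ᵀ * minOp (Matrix.of (L t)) (Matrix.of (Q t)))⁻¹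
            * ((-(flucCov (Matrix.of (L t)) (Matrix.of (Q t)) * L₁ * minOp (Matrix.of (L t)) (Matrix.of (Q t))
                  + minOp (Matrix.of (L t)) (Matrix.of (Q t)) * Q₁ * minOp (Matrix.of (L t)) (Matrix.of (Q t))
                  - flucCov (Matrix.of (L t)) (Matrix.of (Q t)) * Q₁ᵀ * effForm (Matrix.of (L t)) (Matrix.of (Q t))))ᵀ
                * minOp (Matrix.of (L t)) (Matrix.of (Q t))
              + (minOp (Matrix.of (L t)) (Matrix.of (Q t)))ᵀ
                * -(flucCov (Matrix.of (L t)) (Matrix.of (Q t)) * L₁ * minOp (Matrix.of (L t)) (Matrix.of (Q t))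
                  + minOp (Matrix.of (L t)) (Matrix.of (Q t)) * Q₁ * minOp (Matrix.of (L t)) (Matrix.of (Q t))
                  - flucCov (Matrix.of (L t)) (Matrix.of (Q t)) * Q₁ᵀ * effForm (Matrix.of (L t)) (Matrix.of (Q t))))).trace)
        - (1 / 2 : ℝ) * (((Matrix.of (Q t) * (Matrix.of (Q t))ᵀ)⁻¹ * (Q₁ * (Matrix.of (Q t))ᵀ + Matrix.of (Q t) * Q₁ᵀ)).trace)) t := by
  have hkkt : ∀ᶠ u in 𝓝 t, (kkt (Matrix.of (L u)) (Matrix.of (Q u))).det ≠ 0 := by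
    filter_upwards [hK, hPK] with u huK huP
    exact (isUnit_kkt_det_of_reg _ _ A huK huP).ne_zero
  have hdet : (kkt (Matrix.of (L t)) (Matrix.of (Q t))).det ≠ 0 := hkkt.self_of_nhds
  -- the three pieces
  have h1 := hasDerivAt_logAbsDet_kkt hL hQ hsym.self_of_nhds hdet
  have h2 := hasDerivAt_log_det_gram (hasDerivAt_minOp hL hQ hsym.self_of_nhds hdet) hkkt
  have h3 : HasDerivAt (fun u => Real.log |(Matrix.of (Q u) * (Matrix.of (Q u))ᵀ).det|)
      (((Matrix.of (Q t) * (Matrix.of (Q t))ᵀ)⁻¹ * (Q₁ * (Matrix.of (Q t))ᵀ + Matrix.of (Q t) * Q₁ᵀ)).trace) t :=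
    hasDerivAt_logAbsDet (A := fun u => Matrix.of.symm (Matrix.of (Q u) * (Matrix.of (Q u))ᵀ))
      (A₁ := Q₁ * (Matrix.of (Q t))ᵀ + Matrix.of (Q t) * Q₁ᵀ) (hasDerivAt_gramQ hQ) hG
  have hsum := (h1.add (h2.const_mul (1 / 2 : ℝ))).sub (h3.const_mul (1 / 2 : ℝ))
  -- near `t` the ghost log-determinant IS the sum of the three pieces (FILE 1, singular-safe Gram split)
  have heq : ∀ᶠ u in 𝓝 t, ghostLogDet (Matrix.of (L u)) (Matrix.of (Q u)) =
      Real.log |(kkt (Matrix.of (L u)) (Matrix.of (Q u))).det|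
        + (1 / 2 : ℝ) * Real.log ((minOp (Matrix.of (L u)) (Matrix.of (Q u)))ᵀ * minOp (Matrix.of (L u)) (Matrix.of (Q u))).det
        - (1 / 2 : ℝ) * Real.log |(Matrix.of (Q u) * (Matrix.of (Q u))ᵀ).det| := by
    filter_upwards [hsym, hK, hPK] with u hus huK huP
    exact ghostLogDet_eq_kkt_add_gram_of_reg _ _ A hus hA huK huP
  refine (hsum.congr_of_eventuallyEq heq).congr_deriv ?_
  ring

/-! ## §5 The polarization: second variation = six KKT loops at the scalar data + Gram loops -/

/-- [folklore] **THE GRAM LOOPS, abstract jets**: if `u ↦ 𝓘_u := minOp (H u) (Q u)` has derivative `I₁ u` at every `u` near `t`, `I₁` has derivative `I₂`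
at `t`, and the bordered matrix is non-degenerate at `t`, then the Gram first-variation density `u ↦ tr((𝓘_uᵀ𝓘_u)⁻¹·(I₁ uᵀ𝓘_u + 𝓘_uᵀI₁ u))` has derivative
`secondVar (𝓘ᵀ𝓘) (I₁ᵀ𝓘 + 𝓘ᵀI₁) (I₂ᵀ𝓘 + I₁ᵀI₁ + (I₁ᵀI₁ + 𝓘ᵀI₂))` at `t` — legs `(𝓘ᵀ𝓘)⁻¹`, vertices the jets of `𝓘` (themselves words in
`Γ, 𝓘, 𝔊` and `L̇, L̈, Q̇, Q̈`, §2). -/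
theorem hasDerivAt_gramFirstVar {H : ℝ → ν → ν → ℝ} {Q : ℝ → μ → ν → ℝ} {I₁ : ℝ → ν → μ → ℝ} {I₂ : Matrix ν μ ℝ} {t : ℝ}
    (hI : ∀ᶠ u in 𝓝 t, HasDerivAt (fun u => Matrix.of.symm (minOp (Matrix.of (H u)) (Matrix.of (Q u)))) (I₁ u) u)
    (hI₁ : HasDerivAt I₁ (Matrix.of.symm I₂) t) (hdet : (kkt (Matrix.of (H t)) (Matrix.of (Q t))).det ≠ 0) :
    HasDerivAt (fun u => ((((minOp (Matrix.of (H u)) (Matrix.of (Q u)))ᵀ * minOp (Matrix.of (H u)) (Matrix.of (Q u)))⁻¹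
        * ((Matrix.of (I₁ u))ᵀ * minOp (Matrix.of (H u)) (Matrix.of (Q u)) + (minOp (Matrix.of (H u)) (Matrix.of (Q u)))ᵀ * Matrix.of (I₁ u))).trace))
      (secondVar ((minOp (Matrix.of (H t)) (Matrix.of (Q t)))ᵀ * minOp (Matrix.of (H t)) (Matrix.of (Q t)))
        ((Matrix.of (I₁ t))ᵀ * minOp (Matrix.of (H t)) (Matrix.of (Q t)) + (minOp (Matrix.of (H t)) (Matrix.of (Q t)))ᵀ * Matrix.of (I₁ t))
        (I₂ᵀ * minOp (Matrix.of (H t)) (Matrix.of (Q t)) + (Matrix.of (I₁ t))ᵀ * Matrix.of (I₁ t)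
          + ((Matrix.of (I₁ t))ᵀ * Matrix.of (I₁ t) + (minOp (Matrix.of (H t)) (Matrix.of (Q t)))ᵀ * I₂))) t := by
  -- the Gram curve and its first jet curve
  have hI' : ∀ᶠ u in 𝓝 t, HasDerivAt (fun u => Matrix.of.symm (minOp (Matrix.of (H u)) (Matrix.of (Q u))))
      (Matrix.of.symm (Matrix.of (I₁ u))) u := hI
  have hM : HasDerivAt (fun u => Matrix.of.symm ((minOp (Matrix.of (H u)) (Matrix.of (Q u)))ᵀ * minOp (Matrix.of (H u)) (Matrix.of (Q u))))
      ((fun u => Matrix.of.symm ((Matrix.of (I₁ u))ᵀ * minOp (Matrix.of (H u)) (Matrix.of (Q u))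
        + (minOp (Matrix.of (H u)) (Matrix.of (Q u)))ᵀ * Matrix.of (I₁ u))) t) t := hasDerivAt_gram hI'.self_of_nhds
  -- the first jet curve `u ↦ I₁ uᵀ 𝓘_u + 𝓘_uᵀ I₁ u` has derivative `I₂ᵀ𝓘 + I₁ᵀI₁ + I₁ᵀI₁ + 𝓘ᵀI₂`
  have hA := hasDerivAt_transpose_mul (X := I₁) (Y := fun u => Matrix.of.symm (minOp (Matrix.of (H u)) (Matrix.of (Q u)))) hI₁ hI'.self_of_nhds
  have hB := hasDerivAt_transpose_mul (X := fun u => Matrix.of.symm (minOp (Matrix.of (H u)) (Matrix.of (Q u)))) (Y := I₁) hI'.self_of_nhds hI₁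
  have hM₁ : HasDerivAt (fun u => Matrix.of.symm ((Matrix.of (I₁ u))ᵀ * minOp (Matrix.of (H u)) (Matrix.of (Q u))
        + (minOp (Matrix.of (H u)) (Matrix.of (Q u)))ᵀ * Matrix.of (I₁ u)))
      (Matrix.of.symm (I₂ᵀ * minOp (Matrix.of (H t)) (Matrix.of (Q t)) + (Matrix.of (I₁ t))ᵀ * Matrix.of (I₁ t)
        + ((Matrix.of (I₁ t))ᵀ * Matrix.of (I₁ t) + (minOp (Matrix.of (H t)) (Matrix.of (Q t)))ᵀ * I₂))) t := hA.add hB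
  have hpos : (Matrix.of (Matrix.of.symm ((minOp (Matrix.of (H t)) (Matrix.of (Q t)))ᵀ * minOp (Matrix.of (H t)) (Matrix.of (Q t))))).det ≠ 0 :=
    (det_gram_pos _ _ (isUnit_iff_ne_zero.2 hdet)).ne'
  exact hasDerivAt_trace_inv_mul hM hM₁ hpos

/-- [folklore] **THE POLARIZATION OF THE K_n-GHOST (second variation of `ghostLogDet` along a `C²` curve).**  The first-variation density of §4,
`g u := tr(𝕂_u⁻¹·kkt (L₁ u) (Q₁ u)) + ½·tr((𝓘_uᵀ𝓘_u)⁻¹(I₁ uᵀ𝓘_u + 𝓘_uᵀI₁ u)) − ½·tr((Q_uQ_uᵀ)⁻¹·C₁ u)` (with `tr(𝕂⁻¹𝕂̇) = tr(ΓL̇) + 2tr(𝓘Q̇)` for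
symmetric `L u`, `KKTSecondVariation.trace_kktInv_mul_kkt_symm`; `I₁` the jet of `𝓘`, §2; `C₁` the jet of `QQᵀ`, §4), has derivative at `t`
`secondVar 𝕂 𝕂̇ 𝕂̈ + ½·secondVar (𝓘ᵀ𝓘) Ṁ M̈ − ½·secondVar (QQᵀ) Ċ C̈`
— and `−½·secondVar 𝕂 𝕂̇ 𝕂̈` IS the SIX LOOPS `KKTSecondVariation.sixLoops_kkt` at the scalar data `(H, Q) := (L t, Q t)` (so the first term is `−2`× the
six loops), the second term is the GRAM LOOP CATALOGUE of `hasDerivAt_gramFirstVar`, the third vanishes for a static constraint Gram. -/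
theorem hasDerivAt_ghostFirstVar {L L₁ : ℝ → ν → ν → ℝ} {L₂ : Matrix ν ν ℝ} {Q Q₁ : ℝ → μ → ν → ℝ} {Q₂ : Matrix μ ν ℝ}
    {I₁ : ℝ → ν → μ → ℝ} {I₂ : Matrix ν μ ℝ} {C₁ : ℝ → μ → μ → ℝ} {C₂ : Matrix μ μ ℝ} {t : ℝ}
    (hL : HasDerivAt L (L₁ t) t) (hL₁ : HasDerivAt L₁ (Matrix.of.symm L₂) t)
    (hQ : HasDerivAt Q (Q₁ t) t) (hQ₁ : HasDerivAt Q₁ (Matrix.of.symm Q₂) t)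
    (hI : ∀ᶠ u in 𝓝 t, HasDerivAt (fun u => Matrix.of.symm (minOp (Matrix.of (L u)) (Matrix.of (Q u)))) (I₁ u) u)
    (hI₁ : HasDerivAt I₁ (Matrix.of.symm I₂) t)
    (hC : HasDerivAt (fun u => Matrix.of.symm (Matrix.of (Q u) * (Matrix.of (Q u))ᵀ)) (C₁ t) t) (hC₁ : HasDerivAt C₁ (Matrix.of.symm C₂) t)
    (hdet : (kkt (Matrix.of (L t)) (Matrix.of (Q t))).det ≠ 0) (hG : (Matrix.of (Q t) * (Matrix.of (Q t))ᵀ).det ≠ 0) :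
    HasDerivAt (fun u => ((kkt (Matrix.of (L u)) (Matrix.of (Q u)))⁻¹ * kkt (Matrix.of (L₁ u)) (Matrix.of (Q₁ u))).trace
        + (1 / 2 : ℝ) * ((((minOp (Matrix.of (L u)) (Matrix.of (Q u)))ᵀ * minOp (Matrix.of (L u)) (Matrix.of (Q u)))⁻¹
          * ((Matrix.of (I₁ u))ᵀ * minOp (Matrix.of (L u)) (Matrix.of (Q u)) + (minOp (Matrix.of (L u)) (Matrix.of (Q u)))ᵀ * Matrix.of (I₁ u))).trace)
        - (1 / 2 : ℝ) * (((Matrix.of (Q u) * (Matrix.of (Q u))ᵀ)⁻¹ * Matrix.of (C₁ u)).trace))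
      (secondVar (kkt (Matrix.of (L t)) (Matrix.of (Q t))) (kkt (Matrix.of (L₁ t)) (Matrix.of (Q₁ t))) (kkt L₂ Q₂)
        + (1 / 2 : ℝ) * secondVar ((minOp (Matrix.of (L t)) (Matrix.of (Q t)))ᵀ * minOp (Matrix.of (L t)) (Matrix.of (Q t)))
            ((Matrix.of (I₁ t))ᵀ * minOp (Matrix.of (L t)) (Matrix.of (Q t)) + (minOp (Matrix.of (L t)) (Matrix.of (Q t)))ᵀ * Matrix.of (I₁ t))
            (I₂ᵀ * minOp (Matrix.of (L t)) (Matrix.of (Q t)) + (Matrix.of (I₁ t))ᵀ * Matrix.of (I₁ t)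
              + ((Matrix.of (I₁ t))ᵀ * Matrix.of (I₁ t) + (minOp (Matrix.of (L t)) (Matrix.of (Q t)))ᵀ * I₂))
        - (1 / 2 : ℝ) * secondVar (Matrix.of (Q t) * (Matrix.of (Q t))ᵀ) (Matrix.of (C₁ t)) C₂) t := by
  have h1 := hasDerivAt_firstVar_kkt hL hL₁ hQ hQ₁ hdet
  have h2 := hasDerivAt_gramFirstVar hI hI₁ hdet
  have h3 : HasDerivAt (fun u => ((Matrix.of (Q u) * (Matrix.of (Q u))ᵀ)⁻¹ * Matrix.of (C₁ u)).trace)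
      (secondVar (Matrix.of (Q t) * (Matrix.of (Q t))ᵀ) (Matrix.of (C₁ t)) C₂) t :=
    hasDerivAt_trace_inv_mul (A := fun u => Matrix.of.symm (Matrix.of (Q u) * (Matrix.of (Q u))ᵀ)) hC hC₁ hG
  exact (h1.add (h2.const_mul (1 / 2 : ℝ))).sub (h3.const_mul (1 / 2 : ℝ))

/-- [folklore] **READING OF THE FIRST TERM**: `secondVar 𝕂 𝕂̇ 𝕂̈ = −2·(six loops)` at the scalar data — `KKTSecondVariation.sixLoops_kkt` BY NAME (symmetric
`L`, `L₁`). -/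
theorem secondVar_kkt_eq_neg_two_mul_sixLoops (L L₁ L₂ : Matrix ν ν ℝ) (Q Q₁ Q₂ : Matrix μ ν ℝ) (hL : Lᵀ = L) (hL₁ : L₁ᵀ = L₁) :
    secondVar (kkt L Q) (kkt L₁ Q₁) (kkt L₂ Q₂) =
      -2 * ((1 / 2 : ℝ) * (flucCov L Q * L₁ * (flucCov L Q * L₁)).trace
        - (1 / 2 : ℝ) * (flucCov L Q * L₂).trace
        + 2 * (flucCov L Q * L₁ * (minOp L Q * Q₁)).trace
        + (minOp L Q * Q₁ * (minOp L Q * Q₁)).trace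
        - (effForm L Q * (Q₁ * (flucCov L Q * Q₁ᵀ))).trace
        - (minOp L Q * Q₂).trace) := by
  rw [← sixLoops_kkt L L₁ L₂ Q Q₁ Q₂ hL hL₁]
  ring

end Calculus

end Summit.QuantumFields.BalabanUV.Beta.FP.GhostGramJets

end
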